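import Mathlib
import HarnessLib
import Summits.HubbardSuperconductivity.HubbardSuperconductivity.Theorems.KLProgrammeKLRegimeEngineV8TowerExports2
import Summits.HubbardSuperconductivity.HubbardSuperconductivity.Theorems.KLProgrammeKLRegimeEngineV8DefsQ8
import Summits.HubbardSuperconductivity.HubbardSuperconductivity.Theorems.KLProgrammeKLRegimeEngineV8DefsG8
import Summits.HubbardSuperconductivity.HubbardSuperconductivity.Theorems.KLProgrammeKLRegimeEngineV8DefsU7
import Summits.HubbardSuperconductivity.HubbardSuperconductivity.Theorems.KLProgrammeKLRegimeEngineKernelNormsWt4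
import Summits.HubbardSuperconductivity.HubbardSuperconductivity.Theorems.KLProgrammeKLRegimeKernelNormsLevelsDefs
import Summits.HubbardSuperconductivity.HubbardSuperconductivity.Theorems.KLProgrammeKLRegimeEngineV8TwoLegMomentsExportGrid

/-!
# Route `KLProgramme` — ENGINE child gen 8 (stmt-HubbardSuperconductivity-20437 `KLRegimeEngineV17F2`), SKELETON v2, TABLE B′-DEFERRED:
# the tower's public constant `klTowerCE P R` as a DEFERRED package (plan g19 (R59v)(A) «B′-DEFERRED GO», 2026-08-27; E1 lead r2d-p2 g7)

WHY ((b)-CE-FIT = NO, E1 word evidence #40 / J-R7h(B)).  Stub (b) v2 concludes the ε-currency clause `KernelNormsV4 L M P Q β U μ (K_n) n` (law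
`Q.CE^p ε_n^{p−1} 2^{(3p−5)n}`) and the weighted clause at `klWtBudget P Q U j` — both read the table constant `Q.CE` — for `Q = klEngQ9 P R`.  The one-shot
blocked tower that proves them (E1 kit `…EngineTower*`, parts 1–11b) has a PUBLIC read-out constant `CE_pub ≥ B·Q·c₂·E·8^d ≥ 2^222` (memo
E1-TOWER-BLOCKED §4/§9) that does NOT fit under `(klEngQ8 P R).CE`'s designed room `2^20·klE1CE P ≈ 2^200`; so table B′ takes
`e_T := max (klEngQ8 P R).CE (klTowerCE P R)` in DefsQ9 (k3c2-p1).  No closed-form numeral for `klTowerCE` is certifiable before the U7 split counts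
(`c₂`) and the engine-geometry slice constants (`σ̂, Φ̂`) land, so — exactly as for the class-#1/#3/#6 packages (`klExportPkg2`, `klE5Raise`, `klIsoPkgW`)
and `klWtT` — the constant is DEFERRED: chosen by `Classical.choose` over the tower statement itself, with an explicit default branch.

* §1 **`TowerNormsStep P R Q₀ CE u`** — the (b)-tower's deliverable as a Prop about a candidate constant `CE` and a CE-aware coupling threshold `u`:
  for every RAISE `Q` of the key package `Q₀` with `CE ≤ Q.CE` ((k1) raise-genericity; the tower reads no field of any `Q` — its imports are the R-keyed
  two-leg slot, the `Q.CL` rates (raise-invariant) and the G-keyed value line), under (b) v2's binders VERBATIM (geometry PINNED at the fixed token #15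
  `klEngGeo8`, which the tower reads quantitatively through the quartic import `IsoTupleL1AtV17F … G …`; door `klEngU₀10`; `U ≤ u Q cc`; `klEngL₄ P R`,
  `klEngM₃`; `1 ≤ n ≤ nScales β + 1`; `IsKLRegime`; `HistP klPredsV17F2 … klEngGeo8 P Q R …`; `FrameOK`; the class-#1 merged exports `hlevU` at
  `klCU2 P R (klEngQ7 P R)`), (b) v2's FOUR conclusion conjuncts VERBATIM at `(klEngGeo8, Q)` (render of record rev 4-Yprime c3423d2a87afbe3e: `KernelNormsV4`,
  the levels/weighted pair at every `j ≤ n`, `EngineFirstMoments`, and the (Y′)-GRID two-leg moments line `TwoLegGridFlowMomentsAt` with the pen's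
  (A)-literal budgets `2^10|2^11 · e^18 · √(2·(7+1606732))⁴ · klE3Acum R`).
* §2 `IsTowerPkg e` (`0 ≤ e.1`, threshold positive everywhere); the DEFERRED package **`klTowerPkg P R`** := some admissible `(CE, u)` with
  `TowerNormsStep P R (klEngQ8 P R) CE u` if one exists, ELSE `(|(klEngQ8 P R).CE|, fun _ _ => 1)` (so DefsQ9/DefsU11 are well formed in both branches);
  **`klTowerCE P R := (klTowerPkg P R).1`**, **`klTowerU P R := (klTowerPkg P R).2`** (DefsU11 row `⊓ klTowerU P R (QT P R) cc`); unconditional rows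
  `isTowerPkg_klTowerPkg`, `klTowerCE_nonneg`, `klTowerU_pos`; the `choose_spec` rows `towerNormsStep_klTower_of_exists/_of`; the else-branch readers.
HOW (b) v2 CLOSES UNDER B′ (k3c2-p1's DefsQ9 B′ supplies `isRaiseOf_klEngQ9_klEngQ8 : (klEngQ8 P R).IsRaiseOf (klEngQ9 P R)` and
`klTowerCE_le_klEngQ9_CE : klTowerCE P R ≤ (klEngQ9 P R).CE := le_max_right _ _`; DefsU11 supplies `klEngU₀11 ≤ klEngU₀10` and `klEngU₀11 ≤ klTowerU P R (QT P R) cc`):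
`stub_engine_step_norms := fun P R c hP hR hc hc6 μ hμ U hU hU11 … => towerNormsStep_klTower_of_exists (exists_towerPkg P R hP hR) (klEngQ9 P R)
(isRaiseOf_klEngQ9_klEngQ8 P R) (klTowerCE_le_klEngQ9_CE P R) c hc hc6 μ hμ U hU (hU11.trans …) (hU11.trans …) …` — where
**`exists_towerPkg : P.WF → R.WF2 → ∃ e, IsTowerPkg e ∧ TowerNormsStep P R (klEngQ8 P R) e.1 e.2`** is THE tower theorem (E1 lineage; B-sized; the content
of stub (b)), not in this file.  Without it nothing here closes anything: the deferred form relocates, it does not weaken (K4 pattern).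
Definitions with bodies + bookkeeping rows; nothing about the model is asserted; nothing asserts superconductivity.
-/

noncomputable section

namespace Summit.HubbardSuperconductivity.HubbardSuperconductivity.Theorems.EngineV8

set_option linter.dupNamespace false -- summit = problem name (single-conjunct summit), D-0017

open Real Finset Literature.MathematicalPhysics.QuantumLattice Literature.Probability.LatticeModels
open Literature.MathematicalPhysics.QuantumLattice.FermiRG
open Summit.HubbardSuperconductivity.HubbardSuperconductivity.Theorems.KLRegimeSplit
open Summit.HubbardSuperconductivity.HubbardSuperconductivity.Theorems.KLProgrammeLegKernels
open Summit.HubbardSuperconductivity.HubbardSuperconductivity.Theorems.DispersionFlow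

/-! ## §1 The tower's deliverable as a Prop about a candidate constant -/

/-- **`TowerNormsStep P R Q₀ CE u`** — the one-shot blocked tower's deliverable for a candidate public constant `CE` and a CE-aware coupling threshold
`u`: for every raise `Q` of the key package `Q₀` whose `CE`-entry dominates the candidate (`CE ≤ Q.CE`), under stub (b) v2's binders VERBATIM (geometry
pinned at `klEngGeo8`; door `klEngU₀10`; `U ≤ u Q cc`; `klEngL₄ P R`, `klEngM₃`; `1 ≤ n ≤ nScales β + 1`, `IsKLRegime`; the history at
`(klEngGeo8, P, Q, R)`; `FrameOK (K_n)`; the class-#1 merged exports at every `j ≤ n`), the FOUR conclusion conjuncts of (b) v2 VERBATIM at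
`(klEngGeo8, Q)`: `KernelNormsV4 … Q … (K_n) n`, `∀ j ≤ n, KernelNormsLevels … Q … (K_n) j ∧ KernelNormsWt4 (klWtBudget P Q U j) … (K_n) j`,
`EngineFirstMoments … klEngGeo8 P Q … (K_n) n`, and the (Y′)-GRID two-leg moments line with the (A)-literal budgets. -/
def TowerNormsStep (P : SplitConsts) (R : RenConsts) (Q₀ : EngConsts) (CE : ℝ) (u : EngConsts → ℝ → ℝ) : Prop :=
  ∀ Q : EngConsts, Q₀.IsRaiseOf Q → CE ≤ Q.CE →
    ∀ cc : ℝ, 0 < cc → cc ≤ klEngC₃6 P R →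
      ∀ μ ∈ klWindowC, ∀ U : ℝ, 0 < U → U ≤ klEngU₀10 P R cc → U ≤ u Q cc →
        ∀ β : ℝ, klBetaMin ≤ β → β ≤ Real.exp (cc / U ^ 2) →
          ∀ (L M : ℕ) [NeZero L] [NeZero M], klEngL₄ P R β U ≤ L → klEngM₃ β U L ≤ M →
            ∀ n : ℕ, 1 ≤ n → n ≤ nScales β + 1 → IsKLRegime U cc (-(n : ℤ)) →
              HistP klPredsV17F2 L M klEngGeo8 P Q R β U μ 0 n →
                FrameOK R U (nScales β) μ (klFlowFrameU L M β U μ n) →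
                  (∀ j ≤ n, LevelsUExportMixedAt L M (klCU2 P R (klEngQ7 P R)) P β U μ j) →
                    KernelNormsV4 L M P Q β U μ (klFlowFrameU L M β U μ n) n ∧
                      (∀ j ≤ n, (KernelNormsLevels L M P Q β U μ (klFlowFrameU L M β U μ n) j ∧
                        KernelNormsWt4 L M (klWtBudget P Q U j) β U μ (klFlowFrameU L M β U μ n) j)) ∧
                      EngineFirstMoments L M klEngGeo8 P Q β U μ (klFlowFrameU L M β U μ n) n ∧
                      TwoLegGridFlowMomentsAt L M ((2 : ℝ) ^ 10 * Real.exp 1 ^ 18 * Real.sqrt (2 * (7 + 1606732)) ^ 4 * klE3Acum R)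
                        ((2 : ℝ) ^ 11 * Real.exp 1 ^ 18 * Real.sqrt (2 * (7 + 1606732)) ^ 4 * klE3Acum R) β U μ n

/-- **`TowerNormsStep` is antitone in the candidate constant's demand**: a package that works for `CE` works for every `CE' ≥ CE`?  No — the other way:
if the tower closes whenever `CE ≤ Q.CE`, it closes a fortiori whenever `CE' ≤ Q.CE` with `CE ≤ CE'` (fewer raises qualify). -/
theorem TowerNormsStep.mono_CE {P : SplitConsts} {R : RenConsts} {Q₀ : EngConsts} {CE CE' : ℝ} {u : EngConsts → ℝ → ℝ}
    (h : TowerNormsStep P R Q₀ CE u) (hle : CE ≤ CE') : TowerNormsStep P R Q₀ CE' u :=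
  fun Q hQ hCE => h Q hQ (hle.trans hCE)

/-- **`TowerNormsStep` is antitone in the threshold**: a smaller coupling threshold `u' ≤ u` only removes couplings. -/
theorem TowerNormsStep.anti_u {P : SplitConsts} {R : RenConsts} {Q₀ : EngConsts} {CE : ℝ} {u u' : EngConsts → ℝ → ℝ}
    (h : TowerNormsStep P R Q₀ CE u) (hle : ∀ Q cc, u' Q cc ≤ u Q cc) : TowerNormsStep P R Q₀ CE u' :=
  fun Q hQ hCE cc hcc hcc6 μ hμ U hU hU10 hUu => h Q hQ hCE cc hcc hcc6 μ hμ U hU hU10 (hUu.trans (hle Q cc))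

/-! ## §2 The deferred package, its projections and rows -/

/-- **An admissible tower package**: a nonnegative candidate constant and a threshold POSITIVE at every raised package and every regime constant. -/
def IsTowerPkg (e : ℝ × (EngConsts → ℝ → ℝ)) : Prop := 0 ≤ e.1 ∧ ∀ Q cc, 0 < e.2 Q cc

/-- The default package `(|Q₀.CE|, 1)` is admissible for every `Q₀`. -/
theorem isTowerPkg_default (Q₀ : EngConsts) : IsTowerPkg (|Q₀.CE|, fun _ _ => 1) := ⟨abs_nonneg _, fun _ _ => one_pos⟩

section Deferred

variable (P : SplitConsts) (R : RenConsts)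

/-- **The deferred tower package `klTowerPkg P R`**: SOME admissible `(CE, u)` for which `TowerNormsStep P R (klEngQ8 P R) CE u` holds, if one exists,
ELSE the default `(|(klEngQ8 P R).CE|, fun _ _ => 1)` (so that DefsQ9's `e_T := max (klEngQ8 P R).CE (klTowerCE P R)` and DefsU11's `⊓ klTowerU …` row
are well formed — nonnegative constant, positive threshold — in BOTH branches). -/
def klTowerPkg : ℝ × (EngConsts → ℝ → ℝ) :=
  open scoped Classical in
  if h : ∃ e : ℝ × (EngConsts → ℝ → ℝ), IsTowerPkg e ∧ TowerNormsStep P R (klEngQ8 P R) e.1 e.2 then Classical.choose h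
  else (|(klEngQ8 P R).CE|, fun _ _ => 1)

/-- **The tower's public constant `klTowerCE P R`** (table B′: `e_T := max (klEngQ8 P R).CE (klTowerCE P R)` in DefsQ9). -/
def klTowerCE : ℝ := (klTowerPkg P R).1

/-- **The tower's CE-aware coupling threshold `klTowerU P R Q cc`** (DefsU11's `min` term `klTowerU P R (QT P R) cc`). -/
def klTowerU : EngConsts → ℝ → ℝ := (klTowerPkg P R).2

/-- The deferred tower package is admissible (unconditionally). -/
theorem isTowerPkg_klTowerPkg : IsTowerPkg (klTowerPkg P R) := by
  classical
  unfold klTowerPkg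
  split_ifs with h
  · exact (Classical.choose_spec h).1
  · exact isTowerPkg_default _

/-- `0 ≤ klTowerCE P R` (unconditionally). -/
theorem klTowerCE_nonneg : 0 ≤ klTowerCE P R := (isTowerPkg_klTowerPkg P R).1

/-- `0 < klTowerU P R Q cc` (unconditionally) — so DefsU11's `min` with it keeps the U-door positive. -/
theorem klTowerU_pos (Q : EngConsts) (cc : ℝ) : 0 < klTowerU P R Q cc := (isTowerPkg_klTowerPkg P R).2 Q cc

/-- `(klEngQ8 P R).CE ≤ max (klEngQ8 P R).CE (klTowerCE P R)` — the table-A reading survives inside B′ (DefsQ9's `klEngQ8_CE_le_klEngQ9CE`). -/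
theorem klEngQ8_CE_le_max_klTowerCE : (klEngQ8 P R).CE ≤ max (klEngQ8 P R).CE (klTowerCE P R) := le_max_left _ _

/-- `klTowerCE P R ≤ max (klEngQ8 P R).CE (klTowerCE P R)` — what the (b) v2 closer feeds as `CE ≤ Q.CE` at `Q = klEngQ9 P R` (DefsQ9 B′). -/
theorem klTowerCE_le_max_klEngQ8_CE : klTowerCE P R ≤ max (klEngQ8 P R).CE (klTowerCE P R) := le_max_right _ _

variable {P R}

/-- **The tower's deliverable holds for the deferred package as soon as it holds for some admissible package** (`choose_spec`). -/
theorem towerNormsStep_klTower_of_exists (h : ∃ e : ℝ × (EngConsts → ℝ → ℝ), IsTowerPkg e ∧ TowerNormsStep P R (klEngQ8 P R) e.1 e.2) :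
    TowerNormsStep P R (klEngQ8 P R) (klTowerCE P R) (klTowerU P R) := by
  classical
  have hpkg : klTowerPkg P R = Classical.choose h := by
    unfold klTowerPkg
    rw [dif_pos h]
  unfold klTowerCE klTowerU
  rw [hpkg]
  exact (Classical.choose_spec h).2

/-- Packaging an explicit witness `(CE, u)`. -/
theorem towerNormsStep_klTower_of {CE : ℝ} {u : EngConsts → ℝ → ℝ} (hCE : 0 ≤ CE) (hu : ∀ Q cc, 0 < u Q cc)
    (hs : TowerNormsStep P R (klEngQ8 P R) CE u) : TowerNormsStep P R (klEngQ8 P R) (klTowerCE P R) (klTowerU P R) :=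
  towerNormsStep_klTower_of_exists ⟨(CE, u), ⟨hCE, hu⟩, hs⟩

/-- **ELSE branch**: with no admissible witness the deferred package IS the default `(|(klEngQ8 P R).CE|, 1)`. -/
theorem klTowerPkg_of_not_exists (h : ¬ ∃ e : ℝ × (EngConsts → ℝ → ℝ), IsTowerPkg e ∧ TowerNormsStep P R (klEngQ8 P R) e.1 e.2) :
    klTowerPkg P R = (|(klEngQ8 P R).CE|, fun _ _ => 1) := by
  classical
  unfold klTowerPkg
  rw [dif_neg h]

/-- ELSE branch, constant: `klTowerCE P R = |(klEngQ8 P R).CE|` (so `e_T = max Q8.CE |Q8.CE|`: table A degenerate). -/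
theorem klTowerCE_of_not_exists (h : ¬ ∃ e : ℝ × (EngConsts → ℝ → ℝ), IsTowerPkg e ∧ TowerNormsStep P R (klEngQ8 P R) e.1 e.2) :
    klTowerCE P R = |(klEngQ8 P R).CE| := by
  unfold klTowerCE
  rw [klTowerPkg_of_not_exists h]

/-- ELSE branch, threshold: `klTowerU P R = fun _ _ => 1`. -/
theorem klTowerU_of_not_exists (h : ¬ ∃ e : ℝ × (EngConsts → ℝ → ℝ), IsTowerPkg e ∧ TowerNormsStep P R (klEngQ8 P R) e.1 e.2) :
    klTowerU P R = fun _ _ => 1 := by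
  unfold klTowerU
  rw [klTowerPkg_of_not_exists h]

end Deferred

end Summit.HubbardSuperconductivity.HubbardSuperconductivity.Theorems.EngineV8

end
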